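import Summits.QuantumFields.YangMills.Theorems.BalabanLadderROTPythTriple
import Summits.QuantumFields.YangMills.Theorems.BalabanLadderROTClassDefs
import HarnessLib

/-!
# Crux `ROT` (stmt-QuantumFields-20042): the period cells of the TILTED tori `ℝ⁴/R_θ⁻¹(Nℤ⁴)` at Pythagorean angles

Helper file of cell `ym-beyond`, seat p4 (generation g18) — part 2 of its `BalabanLadderROTTiltCells.lean` (3fb7bad633ed4262), split at the
400-line limit and filed by the fleet lead `ym-spine-20042-p1` (g3), `--supports stmt-QuantumFields-20042 --as helper`; companion of
`Theorems/BalabanLadderROTSkewTorus.lean` (`PeriodCell`, Wilson's theory on a skew torus, `PeriodCell.dist` and its covariance) and of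
`Theorems/BalabanLadderROTPythTriple.lean` (part 1: `PythTriple`, `rotZ`, `rotZinv`, `periods`, `window`, `reduce`).

`skewCell t m : PeriodCell 4` realises `ℤ⁴/P`, `P = m·rotZinv(ℤ⁴) = R_θ⁻¹(Nℤ⁴)` (`N = m q`), with the transversal `window t m` and the
reduction `reduce t m`.  `tiltCell t L := skewCell t (max ((2L+1)/q) 1)` is the cell used at torus half-side `L`; on the FITTED class
`fittedClass q = {L : q ∣ 2L+1}` (unbounded for odd `q`, `unboundedClass_fittedClass`) its block count is `(2L+1)/q` and
`R_θ(a·P) = a(2L+1)ℤ⁴` — the straight torus of `latticeDist … L a …` (`planeRot_smul_siteToE_tiltCell_period`, the geometric certificate).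
Instances: King's `(4,3,5)` (`θ = arcsin (3/5)`) and the Bałaban-admissible `(12,5,13)` (`θ = arcsin (5/13)`, odd block factor `13 > 11`;
`irrational_arcsin_five_thirteenths_div_two_pi` by Niven).

Pure integer / trigonometric bookkeeping; nothing asserted about Yang–Mills.  No instance, no named fact, no sorry.
Reference for the geometry: C. King, Commun. Math. Phys. **103** (1986) 323–349, §2 (p. 326–327, (2.24)–(2.25)).
-/

set_option autoImplicit false

noncomputable section

open scoped BigOperators
open Real
open Literature.MathematicalPhysics.QuantumFieldTheory Literature.MathematicalPhysics.QuantumLattice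
open Literature.Probability.LatticeModels (box Site mem_box)

namespace Summit.QuantumFields.YangMills.Theorems.ROT

namespace PythTriple

variable (t : PythTriple)

/-! ## §4 The cells -/

/-- **The period cell of the tilted torus of side `N = m q`** (`m ≥ 1` blocks): `ℤ⁴ / m·rotZinv(ℤ⁴)`. -/
def skewCell (m : ℕ) (hm : 0 < m) : PeriodCell 4 where
  P := t.periods m
  reps := t.window m
  red := t.reduce m
  red_mem := t.reduce_mem_window hm
  red_eq_self := fun _ hy => t.reduce_eq_self_of_mem hm hy
  red_sub_mem := fun y => ⟨-t.cosetIndex m y, by rw [reduce, map_neg, smul_neg]; abel⟩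
  red_add := by
    rintro y _ ⟨z, rfl⟩
    exact t.reduce_add_period hm y z

/-- The period lattice of `skewCell`. [folklore] -/
@[simp] theorem skewCell_P (m : ℕ) (hm : 0 < m) : (t.skewCell m hm).P = t.periods m := rfl
/-- The transversal of `skewCell`. [folklore] -/
@[simp] theorem skewCell_reps (m : ℕ) (hm : 0 < m) : (t.skewCell m hm).reps = t.window m := rfl
/-- The reduction of `skewCell`. [folklore] -/
@[simp] theorem skewCell_red (m : ℕ) (hm : 0 < m) : (t.skewCell m hm).red = t.reduce m := rfl

/-- The block count at torus half-side `L`: `(2L+1)/q`, at least `1` (junk-free totality off the fitted class). -/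
def blocks (L : ℕ) : ℕ := max ((2 * L + 1) / t.q) 1

/-- The block count is positive. [folklore] -/
theorem blocks_pos (L : ℕ) : 0 < t.blocks L := lt_of_lt_of_le Nat.one_pos (le_max_right _ _)

/-- **The tilt cell at torus half-side `L`**: the period cell of the tilted torus with `blocks L` blocks; on the fitted class
(`q ∣ 2L+1`) its side is exactly `2L+1` (`blocks_mul_q`). -/
def tiltCell (L : ℕ) : PeriodCell 4 := t.skewCell (t.blocks L) (t.blocks_pos L)

/-- The class of torus half-sides fitted by the modulus `q`: `q ∣ 2L+1`. -/
def fittedClass (q : ℕ) : Set ℕ := {L | q ∣ 2 * L + 1}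

/-- On the fitted class the block count is `(2L+1)/q`. [folklore] -/
theorem blocks_eq_div {L : ℕ} (hL : t.q ∣ 2 * L + 1) : t.blocks L = (2 * L + 1) / t.q := by
  refine max_eq_left ?_
  exact (Nat.one_le_div_iff t.q_pos).2 (Nat.le_of_dvd (Nat.succ_pos _) hL)

/-- On the fitted class the tilted torus has side `2L+1`: `blocks L · q = 2L+1`. -/
theorem blocks_mul_q {L : ℕ} (hL : t.q ∣ 2 * L + 1) : t.blocks L * t.q = 2 * L + 1 := by
  rw [t.blocks_eq_div hL, Nat.div_mul_cancel hL]

/-- **Geometric certificate** (fitted class): under the tilted embedding `y ↦ R_θ(a y)` every period of `tiltCell t L` is a period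
`a(2L+1)z` of the straight torus of `latticeDist … L a …`. -/
theorem planeRot_smul_siteToE_tiltCell_period (θ : ℝ) (hc : Real.cos θ = t.p / t.q) (hs : Real.sin θ = t.s / t.q) {L : ℕ}
    (hL : t.q ∣ 2 * L + 1) (a : ℝ) {x : Site 4} (hx : x ∈ (t.tiltCell L).P) :
    ∃ z : Site 4, planeRot (0 : Fin 3) θ (a • siteToE x) = (a * (2 * L + 1 : ℕ)) • siteToE z := by
  obtain ⟨z, rfl⟩ := hx
  refine ⟨z, ?_⟩
  rw [LinearIsometryEquiv.map_smul, t.planeRot_siteToE_period θ hc hs, smul_smul, t.blocks_mul_q hL]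

/-- For odd `q` the fitted class is unbounded (`L = qN + (q−1)/2` gives `2L+1 = q(2N+1)`). -/
theorem unboundedClass_fittedClass {q : ℕ} (hq : Odd q) : UnboundedClass (fittedClass q) := by
  intro N
  obtain ⟨k, hk⟩ := hq
  refine ⟨q * N + k, ⟨2 * N + 1, ?_⟩, ?_⟩
  · rw [hk]; ring
  · have h1 : N ≤ q * N := Nat.le_mul_of_pos_left N (by omega)
    omega

/-! ## §5 The two angles -/

/-- King's angle fits `king345`: `cos = 4/5 = p/q`, `sin = 3/5 = s/q`. -/
theorem king345_cos : Real.cos (Real.arcsin (3 / 5)) = king345.p / king345.q := by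
  rw [Real.cos_arcsin, show (1 : ℝ) - (3 / 5) ^ 2 = (4 / 5) ^ 2 by norm_num, Real.sqrt_sq (by norm_num)]
  norm_num [king345]

/-- King's angle fits `king345`: `sin = 3/5 = s/q`. [folklore] -/
theorem king345_sin : Real.sin (Real.arcsin (3 / 5)) = king345.s / king345.q := by
  rw [Real.sin_arcsin (by norm_num) (by norm_num)]; norm_num [king345]

/-- `sin (arcsin (5/13)) = 5/13`. [folklore] -/
theorem sin_arcsin_five_thirteenths : Real.sin (Real.arcsin (5 / 13)) = 5 / 13 :=
  Real.sin_arcsin (by norm_num) (by norm_num)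

/-- `cos (arcsin (5/13)) = 12/13` — the `(5,12,13)` triangle. -/
theorem cos_arcsin_five_thirteenths : Real.cos (Real.arcsin (5 / 13)) = 12 / 13 := by
  rw [Real.cos_arcsin, show (1 : ℝ) - (5 / 13) ^ 2 = (12 / 13) ^ 2 by norm_num]
  exact Real.sqrt_sq (by norm_num)

/-- The `(12,5,13)` angle fits `bal51213`: `cos = 12/13 = p/q`. [folklore] -/
theorem bal51213_cos : Real.cos (Real.arcsin (5 / 13)) = bal51213.p / bal51213.q := by
  rw [cos_arcsin_five_thirteenths]; norm_num [bal51213]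

/-- The `(12,5,13)` angle fits `bal51213`: `sin = 5/13 = s/q`. [folklore] -/
theorem bal51213_sin : Real.sin (Real.arcsin (5 / 13)) = bal51213.s / bal51213.q := by
  rw [sin_arcsin_five_thirteenths]; norm_num [bal51213]

/-- **`arcsin (5/13) / 2π ∉ ℚ`** (Niven: a rational multiple of `π` with rational cosine has cosine in `{−1,−1/2,0,1/2,1}`,
while `cos = 12/13`). [I. Niven, *Irrational Numbers* (1956), Cor. 3.12] -/
theorem irrational_arcsin_five_thirteenths_div_two_pi : Irrational (Real.arcsin (5 / 13) / (2 * π)) := by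
  rintro ⟨q, hq⟩
  have hθ : ∃ r : ℚ, Real.arcsin (5 / 13) = r * π := by
    refine ⟨2 * q, ?_⟩
    have hπ : (π : ℝ) ≠ 0 := Real.pi_ne_zero
    push_cast
    rw [hq]
    field_simp
  have hcos : ∃ q' : ℚ, Real.cos (Real.arcsin (5 / 13)) = q' :=
    ⟨12 / 13, by rw [cos_arcsin_five_thirteenths]; push_cast; ring⟩
  have h := niven hθ hcos
  rw [cos_arcsin_five_thirteenths] at h
  simp only [Set.mem_insert_iff, Set.mem_singleton_iff] at h
  norm_num at h

/-- `5` is odd. [folklore] -/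
theorem odd_five : Odd (5 : ℕ) := ⟨2, rfl⟩
/-- `13` is odd. [folklore] -/
theorem odd_thirteen : Odd (13 : ℕ) := ⟨6, rfl⟩

end PythTriple

end Summit.QuantumFields.YangMills.Theorems.ROT

end
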